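import Literature.Barriers.RiemannHypothesis.EpsteinZetaCentralValue
import Literature.NumberTheory.LFunctions.SiegelAbelSummation
import HarnessLib

/-!
# Hecke's positivity for the Epstein zeta function of a lattice class: `Λ₀,z(σ) ≥ 0`, and the
# principal-class lower bound `Λ₀,z(σ) ≥ 2T^{σ−1}(e^{−π/y} − e^{−πT/y})/(π/y)`

Topic `NumberTheory/QuadraticFields`, namespace `Literature.NumberTheory.QuadraticFields.HeckeLandau`.
Everything here is PROVED (theorems only, no definitions, no named facts). First of two files
formalising Oesterlé's account of the Hecke–Landau theorem (J. Oesterlé, *Le problème de Gauss sur le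
nombre de classes*, Enseign. Math. 34 (1988), II §3, Proposition p. 58: "Si la fonction zêta `ζ_K` du
corps `K = ℚ + ℚi√d` n'admet aucun zéro réel `> 1 − 2/log d`, on a `h(−d) ≥ (2/(πe))√d/log d`");
the class-number inequality itself is `HeckeLandauClassNumberBound.lean`.

For `z ∈ ℍ` (`y = Im z`) let `Θ_z(t) = Σ_{(m,n)∈ℤ²} e^{−πt|mz+n|²/y}`
(`Literature.NumberTheory.Automorphic.thetaQ`) and `Λ_z = Λ₀,z − 1/s − 1/(1−s)` the completed Epstein
zeta function of the lattice `ℤz + ℤ` in Riemann's normalisation (Mathlib `WeakFEPair.Λ`, `Λ₀` of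
`Literature.NumberTheory.Automorphic.thetaFEPair z`; for a form `Q = (a, b, c)` of discriminant `−d`
and `z = (b + i√d)/(2a)`, `Z_Q(σ) = π^σ(√d/2)^{−σ}Γ(σ)⁻¹ Λ_z(σ)`,
`Literature.Barriers.RiemannHypothesis.continuation_ofReal_eq`). Oesterlé's display (22) is the
integral representation `Λ₀,z(σ) = ∫₁^∞ (Θ_z(t) − 1)(t^{σ−1} + t^{−σ}) dt`; in the tree it is
`Re Λ₀,z(σ) = ∫₀^∞ t^{σ−1} Re f̃_z(t) dt` with `f̃_z = 𝟙_{t>1}(Θ_z − 1) + 𝟙_{t<1}(Θ_z − 1/t) ≥ 0`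
(`re_Λ₀_eq_integral`, `re_f_modif_nonneg`, `EpsteinZetaCentralValue.lean`). We prove:

* `one_add_two_mul_exp_le_thetaQ` — the three shortest vectors: `Θ_z(t) ≥ 1 + 2e^{−πt/y}`;
* `re_thetaΛ₀_nonneg` — **`Re Λ₀,z(σ) ≥ 0` for every real `σ`** (Oesterlé: "`Λ(C, α) + (α(1−α))⁻¹`
  est positif pour toute classe `C`");
* `re_thetaΛ₀_ge` — **`Re Λ₀,z(σ) ≥ 2T^{σ−1}(e^{−π/y} − e^{−πT/y})/(π/y)`** for `σ ≤ 1`, `T ≥ 1`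
  (restrict to `t ∈ [1, T]`, where `Θ_z(t) − 1 ≥ 2e^{−πt/y}` and `t^{σ−1} ≥ T^{σ−1}`; Oesterlé keeps
  the whole of `2∫₁^∞ e^{−2πt/√d}(t^{α−1} + t^{−α}) dt` for the neutral class, `y = √d/2`);
* `LFunction_re_nonneg_of_forall_ne_zero` — for a quadratic `χ`: no real zero of `L(s, χ)` on `(α, 1)`
  (`0 < α < 1`) gives `L(α, χ) ≥ 0` (Oesterlé's first step "`ζ_K(α) ≤ 0`", for the factor `L`).

## References

* [Oesterle1988Gauss] J. Oesterlé, *Le problème de Gauss sur le nombre de classes*, Enseign. Math. (2)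
  34 (1988), 43–67, II §3, pp. 56–58 ((22), Proposition, (28)).
* [Landau1918] E. Landau, *Über die Klassenzahl imaginär-quadratischer Zahlkörper*, Gött. Nachr.
  (1918), 285–295 (Hecke's theorem).

## Design

No new definitions; the theta/Epstein infrastructure is the tree's (`ModularEisensteinContinuation.lean`,
`EpsteinZetaCentralValue.lean`). The integral `∫₁^T e^{−kt} dt` is evaluated by the fundamental
theorem of calculus (`integral_exp_neg_mul`, private).
-/

noncomputable section

open Complex Filter Topology MeasureTheory Set Real
open scoped UpperHalfPlane
open Literature.NumberTheory.Automorphic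
open Literature.Barriers.RiemannHypothesis

namespace Literature.NumberTheory.QuadraticFields

namespace HeckeLandau

/-! ## The shortest vectors of `ℤz + ℤ`: `Θ_z(t) ≥ 1 + 2e^{−πt/y}` -/

/-- `Q_z(0, 1) = 1/y`. [folklore] -/
private theorem qForm_zero_one (z : ℍ) : qForm z ![0, 1] = 1 / z.im := by
  simp [qForm]

/-- `Q_z(0, −1) = 1/y`. [folklore] -/
private theorem qForm_zero_neg_one (z : ℍ) : qForm z ![0, -1] = 1 / z.im := by
  simp [qForm]

/-- **The three shortest vectors**: `Θ_z(t) ≥ 1 + 2e^{−πt/y}` (`t > 0`, `y = Im z`), keeping the terms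
`(0, 0)`, `(0, ±1)` of the theta series (Oesterlé 1988, p. 58: the term `2e^{−2πt/√d}` of `θ(C, t) − 1` for
the neutral class). [cite: Oesterle1988Gauss, II §3 p. 58] -/
theorem one_add_two_mul_exp_le_thetaQ (z : ℍ) {t : ℝ} (ht : 0 < t) :
    1 + 2 * Real.exp (-π * t / z.im) ≤ thetaQ z t := by
  have hs := (summable_exp_qForm z ht).hasSum
  have h01 : (0 : Fin 2 → ℤ) ∉ ({![0, 1], ![0, -1]} : Finset (Fin 2 → ℤ)) := by
    simp only [Finset.mem_insert, Finset.mem_singleton, not_or]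
    refine ⟨fun h => ?_, fun h => ?_⟩
    · have := congrFun h 1; simp at this
    · have := congrFun h 1; simp at this
  have h1 : (![0, 1] : Fin 2 → ℤ) ≠ ![0, -1] := by
    intro h; have := congrFun h 1; simp at this
  have h := sum_le_hasSum (insert (0 : Fin 2 → ℤ) ({![0, 1], ![0, -1]} : Finset (Fin 2 → ℤ)))
    (fun v _ => (Real.exp_pos _).le) hs
  rw [Finset.sum_insert h01, Finset.sum_pair h1, qForm_zero, qForm_zero_one, qForm_zero_neg_one] at h
  simp only [mul_zero, Real.exp_zero] at h
  have e : -π * t * (1 / z.im) = -π * t / z.im := by ring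
  rw [e] at h
  unfold thetaQ
  linarith

/-! ## `Λ₀,z(σ) ≥ 0`, and the principal-class lower bound -/

/-- **Positivity class by class**: `Re Λ₀,z(σ) ≥ 0` for every real `σ` (the Mellin integrand
`t^{σ−1}(Θ_z(t) − 1)`, resp. `t^{σ−1}(Θ_z(t) − 1/t)`, is non-negative; Oesterlé 1988, p. 58:
"`Λ(C, α) + (α(1 − α))⁻¹` est positif pour toute classe `C`"). [cite: Oesterle1988Gauss, II §3 p. 58] -/
theorem re_thetaΛ₀_nonneg (z : ℍ) (σ : ℝ) : 0 ≤ ((thetaFEPair z).Λ₀ σ).re := by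
  rw [re_Λ₀_eq_integral]
  exact setIntegral_nonneg measurableSet_Ioi fun t ht =>
    mul_nonneg (Real.rpow_nonneg (le_of_lt ht) _) (re_f_modif_nonneg z ht)

/-- `∫₁^T e^{−kt} dt = (e^{−k} − e^{−kT})/k` (`k ≠ 0`). [folklore] -/
private theorem integral_exp_neg_mul {k : ℝ} (hk : k ≠ 0) (T : ℝ) :
    ∫ t in (1 : ℝ)..T, Real.exp (-k * t) = (Real.exp (-k) - Real.exp (-k * T)) / k := by
  have h : ∀ x ∈ Set.uIcc (1 : ℝ) T,
      HasDerivAt (fun t => -Real.exp (-k * t) / k) (Real.exp (-k * x)) x := by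
    intro x _
    have h1 : HasDerivAt (fun t : ℝ => -k * t) (-k) x := by
      simpa using (hasDerivAt_id x).const_mul (-k)
    refine ((h1.exp.neg).div_const k).congr_deriv ?_
    rw [mul_neg, neg_neg, mul_div_cancel_right₀ _ hk]
  rw [intervalIntegral.integral_eq_sub_of_hasDerivAt h
    ((by fun_prop : Continuous fun t : ℝ => Real.exp (-k * t)).intervalIntegrable _ _)]
  rw [mul_one]
  field_simp
  ring

/-- **The principal-class lower bound**: for `σ ≤ 1` and `T ≥ 1`,
`Re Λ₀,z(σ) ≥ 2 T^{σ−1} (e^{−π/y} − e^{−πT/y})/(π/y)` (`y = Im z`): restrict the Mellin integral to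
`[1, T]`, where `Θ_z(t) − 1 ≥ 2e^{−πt/y}` and `t^{σ−1} ≥ T^{σ−1}` (Oesterlé 1988, p. 58: "et même
supérieur à `2∫₁^∞ e^{−2πt/√d}(t^{α−1} + t^{−α}) dt` lorsque `C` est la classe neutre", keeping the
first term on `[1, T]`). [cite: Oesterle1988Gauss, II §3 p. 58] -/
theorem re_thetaΛ₀_ge (z : ℍ) {σ : ℝ} (hσ1 : σ ≤ 1) {T : ℝ} (hT : 1 ≤ T) :
    2 * T ^ (σ - 1) * ((Real.exp (-(π / z.im)) - Real.exp (-(π / z.im) * T)) / (π / z.im))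
      ≤ ((thetaFEPair z).Λ₀ σ).re := by
  have hy : 0 < z.im := z.im_pos
  have hk : 0 < π / z.im := div_pos Real.pi_pos hy
  set G : ℝ → ℝ := fun t => t ^ (σ - 1) * ((thetaFEPair z).f_modif t).re with hG
  set g : ℝ → ℝ := fun t => T ^ (σ - 1) * (2 * Real.exp (-(π / z.im) * t)) with hg
  rw [re_Λ₀_eq_integral]
  -- restrict to `Ioc 1 T`
  have hsub : ∫ t in Ioc 1 T, G t ≤ ∫ t in Ioi (0 : ℝ), G t := by
    refine setIntegral_mono_set (integrableOn_re_integrand z σ) ?_ ?_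
    · exact (ae_restrict_iff' measurableSet_Ioi).mpr (ae_of_all _ fun t ht =>
        mul_nonneg (Real.rpow_nonneg (le_of_lt ht) _) (re_f_modif_nonneg z ht))
    · exact ae_of_all _ fun t ht => zero_lt_one.trans ht.1
  -- pointwise on `Ioc 1 T`
  have hpt : ∀ t ∈ Ioc (1 : ℝ) T, g t ≤ G t := by
    intro t ht
    have ht0 : 0 < t := lt_of_lt_of_le zero_lt_one ht.1.le
    have h1 : T ^ (σ - 1) ≤ t ^ (σ - 1) := Real.rpow_le_rpow_of_nonpos ht0 ht.2 (by linarith)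
    have h2 : 2 * Real.exp (-(π / z.im) * t) ≤ ((thetaFEPair z).f_modif t).re := by
      rw [re_f_modif_of_one_lt z ht.1]
      have h := one_add_two_mul_exp_le_thetaQ z ht0
      have e : -π * t / z.im = -(π / z.im) * t := by ring
      rw [e] at h
      linarith
    exact mul_le_mul h1 h2 (by positivity) (Real.rpow_nonneg ht0.le _)
  have hgi : IntegrableOn g (Ioc 1 T) :=
    (by fun_prop : Continuous g).integrableOn_Ioc
  have hGi : IntegrableOn G (Ioc 1 T) :=
    (integrableOn_re_integrand z σ).mono_set fun t ht => lt_of_lt_of_le zero_lt_one ht.1.le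
  have hmono : ∫ t in Ioc 1 T, g t ≤ ∫ t in Ioc 1 T, G t :=
    setIntegral_mono_on hgi hGi measurableSet_Ioc hpt
  -- compute `∫ g`
  have hcomp : ∫ t in Ioc 1 T, g t =
      T ^ (σ - 1) * (2 * ((Real.exp (-(π / z.im)) - Real.exp (-(π / z.im) * T)) / (π / z.im))) := by
    rw [← intervalIntegral.integral_of_le hT]
    simp only [hg]
    rw [intervalIntegral.integral_const_mul, intervalIntegral.integral_const_mul,
      integral_exp_neg_mul hk.ne' T]
  calc 2 * T ^ (σ - 1) * ((Real.exp (-(π / z.im)) - Real.exp (-(π / z.im) * T)) / (π / z.im))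
      = ∫ t in Ioc 1 T, g t := by rw [hcomp]; ring
    _ ≤ ∫ t in Ioc 1 T, G t := hmono
    _ ≤ ∫ t in Ioi (0 : ℝ), G t := hsub

/-! ## `L(α, χ) ≥ 0` below a zero-free segment -/

/-- `L(α, χ) ≥ 0` if `L(s, χ)` (`χ` quadratic) has no real zero in `(α, 1)`, `0 < α < 1`: `L(σ, χ) > 0`
on `(α, 1)` (it is real, non-zero on `[σ, 1]`, and `L(1, χ) ≠ 0`), and `L` is continuous at `α` —
Oesterlé's first step, p. 58: "Soit `α ∈ ]½, 1[` tel que `ζ_K` ne s'annule pas dans `]α, 1[`. On a alors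
`ζ_K(α) ≤ 0`" (here for the factor `L(·, χ)`; `ζ(α) < 0`). [cite: Oesterle1988Gauss, II §3 p. 58] -/
theorem LFunction_re_nonneg_of_forall_ne_zero {d : ℕ} [NeZero d] {χ : DirichletCharacter ℂ d}
    (hχ : χ ≠ 1) (hq : χ ^ 2 = 1) {α : ℝ} (hα0 : 0 < α) (hα1 : α < 1)
    (hZ : ∀ σ : ℝ, α < σ → σ < 1 → χ.LFunction σ ≠ 0) : 0 ≤ (χ.LFunction α).re := by
  set g : ℝ → ℝ := fun σ => (χ.LFunction σ).re with hg
  have hcont : Continuous g := Complex.continuous_re.comp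
    ((DirichletCharacter.differentiable_LFunction hχ).continuous.comp Complex.continuous_ofReal)
  have hpos : ∀ σ : ℝ, α < σ → σ < 1 → 0 < g σ := fun σ h1 h2 =>
    Literature.NumberTheory.LFunctions.DirichletAbel.LFunction_ofReal_re_pos_of_forall_ne_zero χ hχ hq
      (hα0.trans h1) h2.le fun τ hτ1 hτ2 => by
        rcases hτ2.lt_or_eq with hτ2 | rfl
        · exact hZ τ (h1.trans_le hτ1) hτ2
        · rw [Complex.ofReal_one]; exact χ.LFunction_apply_one_ne_zero hχ
  have htend : Tendsto g (𝓝[>] α) (𝓝 (g α)) := (hcont.tendsto α).mono_left nhdsWithin_le_nhds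
  refine ge_of_tendsto htend ?_
  filter_upwards [Ioo_mem_nhdsGT hα1] with σ hσ
  exact (hpos σ hσ.1 hσ.2).le

end HeckeLandau

end Literature.NumberTheory.QuadraticFields
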